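import Summits.Ventures.YMGap.Thresholds.ZdTorusKernelTransfer
import HarnessLib

/-!
# Venture YMGap — track (c) «DS», Route X: transfer TOOLS `ℤ^d ↔ (ℤ/L)^d` for window bounds
# (quantitative injectivity of reduction mod `L`, lifting `ℤ^d` boundary data to the torus,
# locality / Lipschitz transport of observables along the periodic lift)

HONEST FRAMING: venture file (cell `pub-ymgap`), lattice bookkeeping only; no measure estimate, no
clustering, nothing about the continuum or the mass gap. These are the plumbing lemmas with which a
window contraction (H1) proved for the TORUS kernels (`DSWindow.StarWindowBound`, Lemma G) is read
on the `ℤ^d` kernels of the infinite-volume specification through the kernel transfer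
`KernelTransfer.integral_ymSpecification_torusLift_eq`.
-/

noncomputable section

open MeasureTheory Filter Topology Finset Function
open Literature.MathematicalPhysics
open Literature.Probability.LatticeModels
open Literature.MathematicalPhysics.QuantumLattice
open Literature.MathematicalPhysics.QuantumFieldTheory (torusWeightSpec torusLogWeight)

namespace Summit.Ventures.YMGap.KernelTransfer

variable {d : ℕ} {G : Type*}

/-! ### Quantitative injectivity of reduction mod `L` -/

/-- **Reduction mod `L` is injective on any set of sites whose coordinates differ by less than `L`.**
[folklore] -/
theorem injOn_torusProj_of_sub_lt {L : ℕ} {B : Set (Site d)}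
    (hB : ∀ x ∈ B, ∀ y ∈ B, ∀ i, |y i - x i| < (L : ℤ)) :
    Set.InjOn (Torus.proj L) B := by
  -- adapted from `LatticeGaugeDLRGibbsProofs.exists_injOn_torusProj`
  intro x hx y hy hxy
  funext i
  have h1 : ((x i : ℤ) : ZMod L) = ((y i : ℤ) : ZMod L) := congr_fun hxy i
  rw [ZMod.intCast_eq_intCast_iff_dvd_sub] at h1
  have := Int.eq_zero_of_abs_lt_dvd h1 (hB x hx y hy i)
  omega

/-- Sites within sup-distance `r` of a centre `s` have coordinates differing by at most `2r`; hence
reduction mod `L` is injective on them once `2r < L`. [folklore] -/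
theorem injOn_torusProj_of_near {L : ℕ} {r : ℕ} (hL : 2 * r < L) (s : Site d) {B : Set (Site d)}
    (hB : ∀ x ∈ B, ∀ i, |x i - s i| ≤ (r : ℤ)) :
    Set.InjOn (Torus.proj L) B := by
  refine injOn_torusProj_of_sub_lt fun x hx y hy i => ?_
  have h1 := hB x hx i
  have h2 := hB y hy i
  have h3 : |y i - x i| ≤ |y i - s i| + |x i - s i| := by
    rw [show y i - x i = (y i - s i) - (x i - s i) by ring]
    exact abs_sub _ _
  have h4 : ((2 * r : ℕ) : ℤ) < (L : ℤ) := by exact_mod_cast hL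
  push_cast at h4
  linarith

/-! ### Lifting `ℤ^d` data to the torus -/

/-- **Lift of a `ℤ^d` configuration to the torus along an injectively projected edge set**: if
`torusEdge L` is injective on `T`, some torus configuration `V` has `torusLift L V = σ` on `T`.
[folklore] -/
theorem exists_torusLift_eqOn [One G] {L : ℕ} {T : Finset (ZdEdge d)}
    (hT : Set.InjOn (torusEdge (d := d) L) ↑T) (σ : LGConfig d G) :
    ∃ V : QuantumFieldTheory.GaugeConfig d L G, ∀ e ∈ T, torusLift L V e = σ e := by
  classical
  refine ⟨fun e' => if h : ∃ e ∈ T, torusEdge L e = e' then σ h.choose else 1, fun e he => ?_⟩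
  have hex : ∃ e₀ ∈ T, torusEdge L e₀ = torusEdge L e := ⟨e, he, rfl⟩
  simp only [torusLift, Function.comp_apply, dif_pos hex]
  obtain ⟨h₁, h₂⟩ := hex.choose_spec
  rw [hT h₁ he h₂]

/-- **Updating the lift at one edge**: if `V` lifts `σ` on `T`, `torusEdge L` is injective on `T`,
`y ∈ T` and `σ' = σ` off `y`, then `Function.update V (torusEdge L y) (σ' y)` lifts `σ'` on `T`.
[folklore] -/
theorem torusLift_update_eqOn {L : ℕ} {T : Finset (ZdEdge d)}
    (hT : Set.InjOn (torusEdge (d := d) L) ↑T) {σ σ' : LGConfig d G} {y : ZdEdge d} (hy : y ∈ T)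
    (hσ : ∀ e, e ≠ y → σ' e = σ e) {V : QuantumFieldTheory.GaugeConfig d L G}
    (hV : ∀ e ∈ T, torusLift L V e = σ e) :
    ∀ e ∈ T, torusLift L (Function.update V (torusEdge L y) (σ' y)) e = σ' e := by
  classical
  intro e he
  simp only [torusLift, Function.comp_apply]
  by_cases hey : e = y
  · subst hey; simp
  · have hne : torusEdge L e ≠ torusEdge L y := fun h => hey (hT he hy h)
    rw [Function.update_of_ne hne, hσ e hey]
    exact hV e he

/-- The updated torus configuration differs from `V` only at `torusEdge L y`. [folklore] -/
theorem update_eq_off {L : ℕ} (V : QuantumFieldTheory.GaugeConfig d L G) (y : ZdEdge d) (g : G) :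
    ∀ e', e' ≠ torusEdge L y → Function.update V (torusEdge L y) g e' = V e' :=
  fun _ h => Function.update_of_ne h _ _

/-! ### Transport of observables along the periodic lift -/

/-- **Locality transport**: an observable of the `ℤ^d` links in `S` becomes, through the periodic
lift, an observable of the torus links `S.image (torusEdge L)` (no injectivity needed). [folklore] -/
theorem dependsOn_toTorusObservable {α : Type*} {L : ℕ} {F : LGConfig d G → α} {S : Finset (ZdEdge d)}
    (hF : DependsOn F (↑S : Set (ZdEdge d))) :
    DependsOn (toTorusObservable L F) (↑(S.image (torusEdge L)) : Set (QuantumFieldTheory.Edge d L)) := by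
  intro W W' h
  simp only [toTorusObservable_apply]
  refine hF fun e he => ?_
  simp only [torusLift, Function.comp_apply]
  exact h _ (Finset.mem_coe.2 (Finset.mem_image_of_mem _ (Finset.mem_coe.1 he)))

/-- **Lipschitz transport**: if `F` reads only the links of `S`, `torusEdge L` is injective on `S`,
and `F` has per-link Lipschitz vector `δ` for a weight `r`, then `F ∘ torusLift L` has the
per-torus-link Lipschitz vector `δ'(x') = Σ_{e ∈ S, torusEdge L e = x'} δ e` (at most one term).
[folklore] -/
theorem lip_toTorusObservable {L : ℕ} {F : LGConfig d G → ℝ} {S : Finset (ZdEdge d)}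
    (hF : DependsOn F (↑S : Set (ZdEdge d))) (hS : Set.InjOn (torusEdge (d := d) L) ↑S)
    {r : G → G → ℝ} {δ : ZdEdge d → ℝ}
    (hlip : ∀ (e : ZdEdge d) (σ τ : LGConfig d G), (∀ e', e' ≠ e → σ e' = τ e') →
      |F σ - F τ| ≤ δ e * r (σ e) (τ e))
    (x' : QuantumFieldTheory.Edge d L) (W W' : QuantumFieldTheory.GaugeConfig d L G)
    (hWW' : ∀ e', e' ≠ x' → W e' = W' e') :
    |toTorusObservable L F W - toTorusObservable L F W'| ≤
      (∑ e ∈ S.filter (fun e => torusEdge L e = x'), δ e) * r (W x') (W' x') := by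
  classical
  simp only [toTorusObservable_apply]
  by_cases hex : ∃ e ∈ S, torusEdge L e = x'
  · obtain ⟨e, heS, hex'⟩ := hex
    -- the filter is the singleton `{e}`
    have hfilt : S.filter (fun e₁ => torusEdge L e₁ = x') = {e} := by
      ext e₁
      simp only [Finset.mem_filter, Finset.mem_singleton]
      constructor
      · rintro ⟨h₁, h₂⟩; exact hS h₁ heS (h₂.trans hex'.symm)
      · rintro rfl; exact ⟨heS, hex'⟩
    rw [hfilt, Finset.sum_singleton]
    -- intermediate configuration: `lift W'` updated at `e` to `W x'`
    set ξ : LGConfig d G := Function.update (torusLift L W') e (W x') with hξ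
    have h1 : F (torusLift L W) = F ξ := by
      refine hF fun e₁ he₁ => ?_
      by_cases h : e₁ = e
      · subst h; simp [hξ, torusLift, hex']
      · have hne : torusEdge L e₁ ≠ x' := fun h' => h (hS he₁ heS (h'.trans hex'.symm))
        simp only [hξ, Function.update_of_ne h, torusLift, Function.comp_apply]
        exact hWW' _ hne
    have h2 : ∀ e', e' ≠ e → ξ e' = torusLift L W' e' := fun e' h => by
      simp only [hξ, Function.update_of_ne h]
    rw [h1]
    have h3 := hlip e ξ (torusLift L W') h2
    have hξe : ξ e = W x' := by simp [hξ]
    have hW'e : torusLift L W' e = W' x' := by simp [torusLift, hex']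
    rw [hξe, hW'e] at h3
    exact h3
  · -- no link of `S` projects to `x'`: `F ∘ lift` does not see `x'`
    have hfilt : S.filter (fun e₁ => torusEdge L e₁ = x') = ∅ :=
      Finset.filter_eq_empty_iff.2 fun e he h => hex ⟨e, he, h⟩
    rw [hfilt, Finset.sum_empty, zero_mul]
    have h1 : F (torusLift L W) = F (torusLift L W') := by
      refine hF fun e₁ he₁ => ?_
      have hne : torusEdge L e₁ ≠ x' := fun h' => hex ⟨e₁, he₁, h'⟩
      simp only [torusLift, Function.comp_apply]
      exact hWW' _ hne
    rw [h1, sub_self, abs_zero]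

/-- The transported Lipschitz vector is nonnegative. [folklore] -/
theorem lipVec_toTorus_nonneg {L : ℕ} {S : Finset (ZdEdge d)} {δ : ZdEdge d → ℝ} (hδ0 : ∀ e, 0 ≤ δ e)
    (x' : QuantumFieldTheory.Edge d L) :
    0 ≤ ∑ e ∈ S.filter (fun e => torusEdge L e = x'), δ e :=
  Finset.sum_nonneg fun e _ => hδ0 e

/-- **Re-indexing the transported Lipschitz vector**: for `k ≥ 0`-free bookkeeping,
`Σ_{x' ∈ S.image torusEdge} k x' · δ'(x') = Σ_{e ∈ S} k (torusEdge L e) · δ e`. [folklore] -/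
theorem sum_image_lipVec_toTorus {L : ℕ} {S : Finset (ZdEdge d)} (δ : ZdEdge d → ℝ)
    (k : QuantumFieldTheory.Edge d L → ℝ) :
    ∑ x' ∈ S.image (torusEdge L), k x' * ∑ e ∈ S.filter (fun e => torusEdge L e = x'), δ e =
      ∑ e ∈ S, k (torusEdge L e) * δ e := by
  classical
  rw [Finset.sum_image']
  intro e he
  rw [Finset.mul_sum]
  refine Finset.sum_congr rfl fun e₁ he₁ => ?_
  rw [(Finset.mem_filter.1 he₁).2]

/-! ### The window-contraction transfer `(ℤ/L)^d → ℤ^d` -/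

section WindowTransfer

variable {N : ℕ} [Group G] [TopologicalSpace G] [IsTopologicalGroup G] [CompactSpace G]
  [MeasurableSpace G] [BorelSpace G] [SecondCountableTopology G]
  (ρ : G →* Matrix (Fin N) (Fin N) ℂ)

/-- **WINDOW CONTRACTION TRANSFER.** Let `Λ` be a finite set of `ℤ^d` links, `y` a link, and
`L` such that reduction mod `L` is injective on the base points of `Λ`, of the plaquettes touching
`Λ`, and of `y`. If the TORUS kernel of the projected window `Λ' = Λ.image (torusEdge L)` contracts
in the one link `y' = torusEdge L y` with an array `k'` — for all torus
configurations `V, V'` equal off `y'` and all bounded measurable `f'` reading only `Λ'` with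
per-link Lipschitz vector `δ' ≥ 0` for a weight `r`:
`|γ'_{Λ'} f'(V) − γ'_{Λ'} f'(V')| ≤ (Σ_{x'∈Λ'} k' x' δ' x') · r(V y', V' y')` —
then the `ℤ^d` kernel `ymSpecification ρ β Λ` contracts in `y` with the pulled-back array
`x ↦ k' (torusEdge L x)`: for all `σ, σ'` equal off `y` and all bounded measurable `f` reading only
`Λ` with per-link Lipschitz vector `δ ≥ 0`,
`|γ_Λ f(σ) − γ_Λ f(σ')| ≤ (Σ_{x∈Λ} k'(torusEdge L x) δ x) · r(σ y, σ' y)`.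
(Kernel transfer `integral_ymSpecification_torusLift_eq` at the two lifted boundary data, which
differ only at `y'`; locality of the kernel in the boundary condition; Lipschitz transport.)
[folklore] -/
theorem window_contraction_of_torus (hρ : Continuous ρ) {β : ℝ} {v : G → ℝ} (hv : Continuous v)
    (hlog : ∀ g, Real.log (v g) = -(β * ((N : ℝ) - (ρ g).trace.re)))
    {r : G → G → ℝ}
    (Λ : Finset (ZdEdge d)) {y : ZdEdge d} {L : ℕ} [NeZero L]
    (hL : Set.InjOn (Torus.proj L)
      ((insert y (Λ ∪ (plaquettesTouching Λ).biUnion plaquetteEdges)).image Prod.fst : Set (Site d)))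
    {k' : QuantumFieldTheory.Edge d L → ℝ}
    (hT : ∀ (V V' : QuantumFieldTheory.GaugeConfig d L G), (∀ e', e' ≠ torusEdge L y → V e' = V' e') →
      ∀ (f' : QuantumFieldTheory.GaugeConfig d L G → ℝ) (δ' : QuantumFieldTheory.Edge d L → ℝ),
        Measurable f' → (∃ B, ∀ U, |f' U| ≤ B) →
        DependsOn f' (↑(Λ.image (torusEdge L)) : Set (QuantumFieldTheory.Edge d L)) → (∀ x', 0 ≤ δ' x') →
        (∀ (x' : QuantumFieldTheory.Edge d L) (W W' : QuantumFieldTheory.GaugeConfig d L G),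
          (∀ e', e' ≠ x' → W e' = W' e') → |f' W - f' W'| ≤ δ' x' * r (W x') (W' x')) →
        |∫ U, f' U ∂(torusWeightSpec (d := d) (L := L) v (Λ.image (torusEdge L)) V) -
            ∫ U, f' U ∂(torusWeightSpec (d := d) (L := L) v (Λ.image (torusEdge L)) V')| ≤
          (∑ x' ∈ Λ.image (torusEdge L), k' x' * δ' x') * r (V (torusEdge L y)) (V' (torusEdge L y)))
    {σ σ' : LGConfig d G} (hσ : ∀ e, e ≠ y → σ e = σ' e)
    {f : LGConfig d G → ℝ} (hfm : Measurable f) (hfb : ∃ B, ∀ U, |f U| ≤ B)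
    (hfdep : DependsOn f (↑Λ : Set (ZdEdge d))) {δ : ZdEdge d → ℝ} (hδ0 : ∀ e, 0 ≤ δ e)
    (hlip : ∀ (e : ZdEdge d) (τ τ' : LGConfig d G), (∀ e', e' ≠ e → τ e' = τ' e') →
      |f τ - f τ'| ≤ δ e * r (τ e) (τ' e)) :
    |∫ U, f U ∂(ymSpecification ρ β Λ σ) - ∫ U, f U ∂(ymSpecification ρ β Λ σ')| ≤
      (∑ x ∈ Λ, k' (torusEdge L x) * δ x) * r (σ y) (σ' y) := by
  classical
  -- the edge set on which everything is read, and injectivity there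
  set T : Finset (ZdEdge d) := insert y (Λ ∪ (plaquettesTouching Λ).biUnion plaquetteEdges) with hTdef
  have hTinj : Set.InjOn (torusEdge (d := d) L) ↑T := injOn_torusEdge hL
  have hyT : y ∈ T := Finset.mem_insert_self _ _
  have hΛT : Λ ⊆ T := fun e he => Finset.mem_insert_of_mem (Finset.mem_union_left _ he)
  have hΛinj : Set.InjOn (torusEdge (d := d) L) ↑Λ := hTinj.mono (Finset.coe_subset.2 hΛT)
  have hL' : Set.InjOn (Torus.proj L)
      ((Λ ∪ Λ ∪ (plaquettesTouching Λ).biUnion plaquetteEdges).image Prod.fst : Set (Site d)) := by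
    refine hL.mono (Finset.coe_subset.2 (Finset.image_subset_image ?_))
    rw [Finset.union_idempotent]
    exact Finset.subset_insert _ _
  -- lift the two boundary data to the torus; they differ only at `y' = torusEdge L y`
  obtain ⟨V, hV⟩ := exists_torusLift_eqOn (G := G) hTinj σ
  set V' : QuantumFieldTheory.GaugeConfig d L G := Function.update V (torusEdge L y) (σ' y) with hV'def
  have hV' : ∀ e ∈ T, torusLift L V' e = σ' e :=
    torusLift_update_eqOn hTinj hyT (fun e he => (hσ e he).symm) hV
  have hVV' : ∀ e', e' ≠ torusEdge L y → V e' = V' e' := fun e' h => (update_eq_off V y (σ' y) e' h).symm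
  -- the `ℤ^d` kernel reads the boundary condition only on `Λ ∪ ∂Λ ⊆ T`
  have hker := dependsOn_integral_ymSpecification ρ hρ β Λ hfm (S₀ := Λ) hfdep
  have hread : ∀ {ξ : LGConfig d G} {W : QuantumFieldTheory.GaugeConfig d L G},
      (∀ e ∈ T, torusLift L W e = ξ e) →
      ∫ U, f U ∂(ymSpecification ρ β Λ ξ) = ∫ U, f U ∂(ymSpecification ρ β Λ (torusLift L W)) := by
    intro ξ W hW
    refine hker fun e he => ?_
    have heT : e ∈ T := by
      refine Finset.mem_insert_of_mem ?_
      rcases Finset.mem_union.1 (Finset.mem_coe.1 he) with h | h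
      · exact Finset.mem_union_left _ h
      · exact Finset.mem_union_right _ h
    exact (hW e heT).symm
  rw [hread hV, hread hV',
    integral_ymSpecification_torusLift_eq ρ hρ hv hlog Λ hfm hfdep hL' V,
    integral_ymSpecification_torusLift_eq ρ hρ hv hlog Λ hfm hfdep hL' V']
  -- the transported observable and its Lipschitz vector
  set δ' : QuantumFieldTheory.Edge d L → ℝ := fun x' => ∑ e ∈ Λ.filter (fun e => torusEdge L e = x'), δ e
    with hδ'def
  have h := hT V V' hVV' (toTorusObservable L f) δ' (hfm.comp (continuous_torusLift L).measurable)
    (hfb.imp fun B hB W => hB _) (dependsOn_toTorusObservable hfdep)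
    (fun x' => lipVec_toTorus_nonneg hδ0 x')
    (fun x' W W' hWW' => lip_toTorusObservable hfdep hΛinj hlip x' W W' hWW')
  -- read the bound back on `ℤ^d`
  have hy1 : V (torusEdge L y) = σ y := by simpa [torusLift] using hV y hyT
  have hy2 : V' (torusEdge L y) = σ' y := by simpa [torusLift] using hV' y hyT
  rw [hy1, hy2, hδ'def, sum_image_lipVec_toTorus δ k'] at h
  exact h

end WindowTransfer

end Summit.Ventures.YMGap.KernelTransfer

end
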